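import Summits.AtomisticToContinuum.BoseEinsteinCondensation.Theorems.BECThomsonPrincipleGDTransferSeededTransportDefs

/-!
# Route `BECThomsonPrinciple`, crux `GDTransfer` (stmt-AtomisticToContinuum-9482), line `seeded-continuity`
# (skeleton v6): stub `stub_dilationL1` — `L¹(ℝ³)`-continuity of dilations, as a two-sided sandwich

For a measurable radial profile `u ≤ B` of finite range `R₀` and `η > 0` we produce `ϑ > 0` such that for every
`b` with `|b − 1| < ϑ` the error profile `w := |b⁻²u(·/b) − u|` (real absolute difference of the finite values,
re-embedded into `ℝ≥0∞`) is measurable, bounded by `4·max B 0`, vanishes beyond `2·max R₀ 0`, has lift of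
`L¹(ℝ³)`-norm `∫ w(|x|) dx ≤ η`, and sandwiches the scaled profile `scaledPotential u b = b⁻²u(·/b)` against `u`
both ways (`DilationL1`, the statement (E) of the transport device of
`BECThomsonPrincipleGDTransferSeededTransportDefs.lean`).

The analytic content is the continuity of dilations in `L¹(ℝ³)` (`dil_integral_dilate_sub_le`): for an
integrable `F : ℝ³ → ℝ`, `∫ |b⁻²F(x/b) − F(x)| dx → 0` as `b → 1`.  Proof: approximate `F` in `L¹` by a continuous
compactly supported `g` (`MeasureTheory.Integrable.exists_hasCompactSupport_integral_sub_le`); the dilate of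
`F − g` has `L¹`-norm `b³·b⁻²·‖F − g‖₁` by the change of variables `x ↦ x/b`
(`MeasureTheory.Measure.integral_comp_inv_smul_of_nonneg`, `finrank_euclideanSpace_fin`); and
`b ↦ ∫ |b⁻²g(x/b) − g(x)| dx` is continuous at `b = 1` by dominated convergence
(`MeasureTheory.continuousAt_of_dominated`), the integrands being bounded by a constant on a fixed ball for
`|b − 1| < 1/2`.

References: LSSY2005 Ch. 5, footnote to (5.3) (scaling of the torus problem); LiebLoss2001 Thm 2.16
(density of `C_c` in `L¹`) — both only as background; everything here is proved from Mathlib.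
-/

noncomputable section

open MeasureTheory Filter Set Metric
open scoped ENNReal NNReal Topology

namespace Summit.AtomisticToContinuum.BoseEinsteinCondensation.Cruxes.GDTransfer.Seeded

open Literature.MathematicalPhysics.QuantumManyBody.BoseGas
open Literature.Barriers.AtomisticToContinuum.BoseGas (scaledPotential)

/-! ## §1 Continuity of dilations in `L¹(ℝ³)` -/

/-- For a continuous compactly supported `g : ℝ³ → ℝ`, the map `b ↦ ∫ |b⁻² g(x/b) − g(x)| dx` is continuous at
`b = 1` (dominated convergence: for `|b − 1| < 1/2` the integrands are bounded by a constant on a fixed ball and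
vanish outside it). [folklore] -/
theorem dil_continuousAt_integral_dilate_sub {g : Space → ℝ} (hg : Continuous g) (hgs : HasCompactSupport g) :
    ContinuousAt (fun b : ℝ => ∫ x : Space, |(b ^ 2)⁻¹ * g (b⁻¹ • x) - g x|) 1 := by
  obtain ⟨C, hC⟩ := hg.bounded_above_of_compact_support hgs
  obtain ⟨r, hr⟩ := hgs.isCompact.isBounded.subset_closedBall (0 : Space)
  set Rg : ℝ := max r 1
  have hRg1 : 1 ≤ Rg := le_max_right _ _
  have hsupp : ∀ y : Space, Rg < ‖y‖ → g y = 0 := fun y hy => by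
    apply image_eq_zero_of_notMem_tsupport
    intro hmem
    have h := hr hmem
    rw [mem_closedBall, dist_zero_right] at h
    exact absurd (h.trans (le_max_left r 1)) (not_le.mpr hy)
  refine continuousAt_of_dominated
    (bound := (closedBall (0 : Space) (2 * Rg)).indicator fun _ => 4 * C + C) ?_ ?_ ?_ ?_
  · -- measurability of the integrands
    refine Eventually.of_forall fun b => Continuous.aestronglyMeasurable ?_
    fun_prop
  · -- domination, for `|b - 1| < 1/2`
    have hball : ball (1 : ℝ) (1 / 2) ∈ 𝓝 (1 : ℝ) := ball_mem_nhds _ (by norm_num)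
    filter_upwards [hball] with b hb
    rw [mem_ball, Real.dist_eq] at hb
    have hb1 : 1 / 2 < b := by linarith [(abs_lt.1 hb).1]
    have hb2 : b < 3 / 2 := by linarith [(abs_lt.1 hb).2]
    have hb0 : 0 < b := by linarith
    refine ae_of_all _ fun x => ?_
    rw [Real.norm_eq_abs, abs_abs]
    by_cases hx : x ∈ closedBall (0 : Space) (2 * Rg)
    · rw [indicator_of_mem hx]
      have hb4 : (b ^ 2)⁻¹ ≤ 4 := by
        rw [inv_le_comm₀ (by positivity) (by norm_num)]
        nlinarith
      have h1 : |(b ^ 2)⁻¹ * g (b⁻¹ • x)| ≤ 4 * C := by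
        rw [abs_mul, abs_inv, abs_of_nonneg (sq_nonneg b)]
        have h := hC (b⁻¹ • x)
        rw [Real.norm_eq_abs] at h
        exact mul_le_mul hb4 h (abs_nonneg _) (by norm_num)
      have h2 : |g x| ≤ C := by simpa only [Real.norm_eq_abs] using hC x
      exact (abs_sub _ _).trans (add_le_add h1 h2)
    · rw [indicator_of_notMem hx]
      rw [mem_closedBall, dist_zero_right, not_le] at hx
      have hgx : g x = 0 := hsupp x (by linarith)
      have hgbx : g (b⁻¹ • x) = 0 := by
        apply hsupp
        rw [norm_smul, norm_inv, Real.norm_of_nonneg hb0.le]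
        calc Rg = b⁻¹ * (b * Rg) := by field_simp
          _ < b⁻¹ * ‖x‖ := by
            refine mul_lt_mul_of_pos_left ?_ (inv_pos.2 hb0)
            calc b * Rg ≤ 2 * Rg := mul_le_mul_of_nonneg_right (by linarith) (by linarith)
              _ < ‖x‖ := hx
      simp [hgx, hgbx]
  · -- integrability of the bound
    exact (integrableOn_const (measure_closedBall_lt_top).ne).integrable_indicator measurableSet_closedBall
  · -- pointwise continuity at `b = 1`
    refine ae_of_all _ fun x => ?_
    have h1 : ContinuousAt (fun b : ℝ => (b ^ 2)⁻¹) 1 := (continuousAt_id.pow 2).inv₀ (by norm_num)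
    have h2 : ContinuousAt (fun b : ℝ => g (b⁻¹ • x)) 1 :=
      hg.continuousAt.comp' ((continuousAt_inv₀ one_ne_zero).smul continuousAt_const)
    exact ((h1.mul h2).sub continuousAt_const).abs

/-- **Continuity of dilations in `L¹(ℝ³)`.**  For an integrable `F : ℝ³ → ℝ` and `η > 0` there is `ϑ > 0` such
that `∫ |b⁻² F(x/b) − F(x)| dx ≤ η` whenever `|b − 1| < ϑ`: approximate `F` in `L¹` by a continuous compactly
supported `g`, change variables in the dilate of `F − g` (Jacobian `b³`), and use
`dil_continuousAt_integral_dilate_sub` for `g`. [folklore] -/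
theorem dil_integral_dilate_sub_le {F : Space → ℝ} (hF : Integrable F) {η : ℝ} (hη : 0 < η) :
    ∃ ϑ : ℝ, 0 < ϑ ∧ ∀ b : ℝ, |b - 1| < ϑ →
      ∫ x : Space, |(b ^ 2)⁻¹ * F (b⁻¹ • x) - F x| ≤ η := by
  have hδ : 0 < η / 4 := by positivity
  obtain ⟨g, hgs, hgF, hg, hgi⟩ := hF.exists_hasCompactSupport_integral_sub_le hδ
  obtain ⟨ϑ₁, hϑ₁, hϑ₁'⟩ :=
    Metric.continuousAt_iff.1 (dil_continuousAt_integral_dilate_sub hg hgs) (η / 4) hδ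
  refine ⟨min (1 / 2) ϑ₁, by positivity, fun b hb => ?_⟩
  have hb' : |b - 1| < 1 / 2 := hb.trans_le (min_le_left _ _)
  have hbϑ : |b - 1| < ϑ₁ := hb.trans_le (min_le_right _ _)
  have hb1 : 1 / 2 < b := by linarith [(abs_lt.1 hb').1]
  have hb2 : b < 3 / 2 := by linarith [(abs_lt.1 hb').2]
  have hb0 : 0 < b := by linarith
  have hFg : ∫ x : Space, |F x - g x| ≤ η / 4 := by simpa only [Real.norm_eq_abs] using hgF
  -- the middle term: `g` against its dilate
  have hmid : ∫ x : Space, |(b ^ 2)⁻¹ * g (b⁻¹ • x) - g x| ≤ η / 4 := by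
    have h := hϑ₁' (show dist b 1 < ϑ₁ by rwa [Real.dist_eq])
    simp only [one_pow, inv_one, one_smul, one_mul, sub_self, abs_zero, integral_zero, Real.dist_eq,
      sub_zero] at h
    exact (le_abs_self _).trans h.le
  -- the first term: the dilate of `F - g`, by the change of variables `x ↦ x / b`
  have hfirst : ∫ x : Space, |(b ^ 2)⁻¹ * (F (b⁻¹ • x) - g (b⁻¹ • x))| ≤ 2 * (η / 4) := by
    have hcv : ∫ x : Space, |F (b⁻¹ • x) - g (b⁻¹ • x)| = b ^ 3 * ∫ x : Space, |F x - g x| := by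
      have h := Measure.integral_comp_inv_smul_of_nonneg volume (fun x : Space => |F x - g x|) hb0.le
      have h3 : Module.finrank ℝ Space = 3 := finrank_euclideanSpace_fin
      rwa [h3, smul_eq_mul] at h
    have h0 : 0 ≤ ∫ x : Space, |F x - g x| := integral_nonneg fun x => abs_nonneg _
    calc ∫ x : Space, |(b ^ 2)⁻¹ * (F (b⁻¹ • x) - g (b⁻¹ • x))|
        = ∫ x : Space, (b ^ 2)⁻¹ * |F (b⁻¹ • x) - g (b⁻¹ • x)| := by
          refine integral_congr_ae (ae_of_all _ fun x => ?_)
          simp only [abs_mul, abs_inv, abs_of_nonneg (sq_nonneg b)]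
      _ = b * ∫ x : Space, |F x - g x| := by
          rw [integral_const_mul, hcv]
          field_simp
      _ ≤ 2 * (η / 4) := by nlinarith
  -- integrability of the three pieces
  have hI1 : Integrable (fun x : Space => |(b ^ 2)⁻¹ * (F (b⁻¹ • x) - g (b⁻¹ • x))|) :=
    (((hF.sub hgi).comp_smul (inv_ne_zero hb0.ne')).const_mul _).abs
  have hI2 : Integrable (fun x : Space => |(b ^ 2)⁻¹ * g (b⁻¹ • x) - g x|) :=
    (((hgi.comp_smul (inv_ne_zero hb0.ne')).const_mul _).sub hgi).abs
  have hI3 : Integrable (fun x : Space => |g x - F x|) := (hgi.sub hF).abs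
  have hptw : ∀ x : Space, |(b ^ 2)⁻¹ * F (b⁻¹ • x) - F x| ≤
      |(b ^ 2)⁻¹ * (F (b⁻¹ • x) - g (b⁻¹ • x))| + |(b ^ 2)⁻¹ * g (b⁻¹ • x) - g x| + |g x - F x| := by
    intro x
    have h : (b ^ 2)⁻¹ * F (b⁻¹ • x) - F x = (b ^ 2)⁻¹ * (F (b⁻¹ • x) - g (b⁻¹ • x)) +
        ((b ^ 2)⁻¹ * g (b⁻¹ • x) - g x) + (g x - F x) := by ring
    rw [h]
    exact (abs_add_le _ _).trans (add_le_add (abs_add_le _ _) le_rfl)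
  calc ∫ x : Space, |(b ^ 2)⁻¹ * F (b⁻¹ • x) - F x|
      ≤ ∫ x : Space, (|(b ^ 2)⁻¹ * (F (b⁻¹ • x) - g (b⁻¹ • x))| +
          |(b ^ 2)⁻¹ * g (b⁻¹ • x) - g x| + |g x - F x|) :=
        integral_mono_of_nonneg (ae_of_all _ fun x => abs_nonneg _) ((hI1.add hI2).add hI3)
          (ae_of_all _ hptw)
    _ = (∫ x : Space, |(b ^ 2)⁻¹ * (F (b⁻¹ • x) - g (b⁻¹ • x))|) +
          (∫ x : Space, |(b ^ 2)⁻¹ * g (b⁻¹ • x) - g x|) + ∫ x : Space, |g x - F x| := by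
        rw [integral_add ?_ hI3, integral_add hI1 hI2]
        exact hI1.add hI2
    _ ≤ 2 * (η / 4) + η / 4 + η / 4 := by
        gcongr
        simpa only [Real.norm_eq_abs, abs_sub_comm] using hgF
    _ = η := by ring

/-! ## §2 `ℝ≥0∞` bookkeeping -/

/-- For finite `a, c : ℝ≥0∞`: `a ≤ c + |a − c|` (real absolute difference, re-embedded). [folklore] -/
theorem dil_le_add_ofReal_abs_sub {a c : ℝ≥0∞} (ha : a ≠ ⊤) (hc : c ≠ ⊤) :
    a ≤ c + ENNReal.ofReal |a.toReal - c.toReal| :=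
  calc a = ENNReal.ofReal a.toReal := (ENNReal.ofReal_toReal ha).symm
    _ ≤ ENNReal.ofReal (c.toReal + |a.toReal - c.toReal|) :=
        ENNReal.ofReal_le_ofReal (by linarith [le_abs_self (a.toReal - c.toReal)])
    _ = c + ENNReal.ofReal |a.toReal - c.toReal| := by
        rw [ENNReal.ofReal_add ENNReal.toReal_nonneg (abs_nonneg _), ENNReal.ofReal_toReal hc]

/-- For finite `a, c : ℝ≥0∞`: `c ≤ a + |a − c|`. [folklore] -/
theorem dil_le_add_ofReal_abs_sub' {a c : ℝ≥0∞} (ha : a ≠ ⊤) (hc : c ≠ ⊤) :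
    c ≤ a + ENNReal.ofReal |a.toReal - c.toReal| := by
  rw [abs_sub_comm]
  exact dil_le_add_ofReal_abs_sub hc ha

/-! ## §3 The stub -/

/-- **Stub `stub_dilationL1` (statement (E) `DilationL1`).**  For a measurable profile `u ≤ B` of range `R₀`
and `η > 0` there is `ϑ > 0` such that for `|b − 1| < ϑ` the profile `w := |b⁻²u(·/b) − u|` is measurable,
`≤ 4·max B 0`, vanishes beyond `2·max R₀ 0`, has `∫_{ℝ³} w(|x|) dx ≤ η`, and
`b⁻²u(|x|/b) ≤ u(|x|) + w(|x|)`, `u(|x|) ≤ b⁻²u(|x|/b) + w(|x|)`.  The `L¹` bound is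
`dil_integral_dilate_sub_le` applied to the bounded compactly supported lift `x ↦ u(|x|)`. -/
theorem stub_dilationL1 : Sig.stub_dilationL1 := by
  intro u hu B hB R₀ hR₀ η hη
  -- finiteness and the real lift
  have hufin : ∀ r, u r ≠ ⊤ := fun r => ((hB r).trans_lt ENNReal.ofReal_lt_top).ne
  have hB0 : 0 ≤ max B 0 := le_max_right _ _
  have huB : ∀ r, (u r).toReal ≤ max B 0 := fun r =>
    ENNReal.toReal_le_of_le_ofReal hB0 ((hB r).trans (ENNReal.ofReal_le_ofReal (le_max_left _ _)))
  set F : Space → ℝ := fun x => (u ‖x‖).toReal with hFdef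
  have hFm : Measurable F := (hu.comp measurable_norm).ennreal_toReal
  have hFint : Integrable F := by
    refine IntegrableOn.integrable_of_forall_notMem_eq_zero (s := closedBall (0 : Space) (max R₀ 0)) ?_ ?_
    · refine Measure.integrableOn_of_bounded (measure_closedBall_lt_top).ne hFm.aestronglyMeasurable
        (M := max B 0) (ae_of_all _ fun x => ?_)
      rw [Real.norm_eq_abs, abs_of_nonneg ENNReal.toReal_nonneg]
      exact huB _
    · intro x hx
      rw [mem_closedBall, dist_zero_right, not_le] at hx
      show (u ‖x‖).toReal = 0
      rw [hR₀ _ ((le_max_left _ _).trans_lt hx), ENNReal.toReal_zero]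
  obtain ⟨ϑ, hϑ, hclose⟩ := dil_integral_dilate_sub_le hFint hη
  refine ⟨min (1 / 2) ϑ, by positivity, fun b hb => ?_⟩
  have hb' : |b - 1| < 1 / 2 := hb.trans_le (min_le_left _ _)
  have hbϑ : |b - 1| < ϑ := hb.trans_le (min_le_right _ _)
  have hb1 : 1 / 2 < b := by linarith [(abs_lt.1 hb').1]
  have hb2 : b < 3 / 2 := by linarith [(abs_lt.1 hb').2]
  have hb0 : 0 < b := by linarith
  have hb4 : (b ^ 2)⁻¹ ≤ 4 := by
    rw [inv_le_comm₀ (by positivity) (by norm_num)]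
    nlinarith
  -- the scaled profile: closed form, finiteness, real value, measurability
  have hsc : ∀ r, scaledPotential u b r = ENNReal.ofReal (b ^ 2)⁻¹ * u (r / b) := fun r => by
    simp only [scaledPotential]
    rw [ENNReal.ofReal_inv_of_pos (by positivity)]
  have hscfin : ∀ r, scaledPotential u b r ≠ ⊤ := fun r => by
    rw [hsc]
    exact ENNReal.mul_ne_top ENNReal.ofReal_ne_top (hufin _)
  have hscR : ∀ r, (scaledPotential u b r).toReal = (b ^ 2)⁻¹ * (u (r / b)).toReal := fun r => by
    rw [hsc, ENNReal.toReal_mul, ENNReal.toReal_ofReal (inv_nonneg.2 (sq_nonneg b))]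
  have hscm : Measurable (scaledPotential u b) := (hu.comp (measurable_id.div_const b)).const_mul _
  -- the error profile `w = |u_b - u|`
  refine ⟨fun r => ENNReal.ofReal |(scaledPotential u b r).toReal - (u r).toReal|, ?_, ?_, ?_, ?_, ?_, ?_⟩
  · -- measurable
    exact (continuous_abs.measurable.comp (hscm.ennreal_toReal.sub hu.ennreal_toReal)).ennreal_ofReal
  · -- bounded by `4 · max B 0`
    intro r
    refine ENNReal.ofReal_le_ofReal (abs_sub_le_iff.2 ⟨?_, ?_⟩)
    · have h1 : (scaledPotential u b r).toReal ≤ 4 * max B 0 := by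
        rw [hscR]
        exact mul_le_mul hb4 (huB _) ENNReal.toReal_nonneg (by norm_num)
      linarith [ENNReal.toReal_nonneg (a := u r)]
    · linarith [ENNReal.toReal_nonneg (a := scaledPotential u b r), huB r]
  · -- vanishing beyond `2 · max R₀ 0`
    intro r hr
    have hR : max R₀ 0 ≤ 2 * max R₀ 0 := by linarith [le_max_right R₀ 0]
    have hur : u r = 0 := hR₀ r ((le_max_left _ _).trans_lt (hR.trans_lt hr))
    have hurb : u (r / b) = 0 := by
      apply hR₀
      rw [lt_div_iff₀ hb0]
      calc R₀ * b ≤ max R₀ 0 * b := mul_le_mul_of_nonneg_right (le_max_left _ _) hb0.le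
        _ ≤ max R₀ 0 * 2 := mul_le_mul_of_nonneg_left (by linarith) (le_max_right _ _)
        _ = 2 * max R₀ 0 := by ring
        _ < r := hr
    simp [hsc, hur, hurb]
  · -- the `L¹(ℝ³)` bound
    have hwx : ∀ x : Space, ENNReal.ofReal |(scaledPotential u b ‖x‖).toReal - (u ‖x‖).toReal| =
        ENNReal.ofReal |(b ^ 2)⁻¹ * F (b⁻¹ • x) - F x| := fun x => by
      simp only [hscR, hFdef, norm_smul, norm_inv, Real.norm_of_nonneg hb0.le, div_eq_inv_mul]
    have hI : Integrable (fun x : Space => |(b ^ 2)⁻¹ * F (b⁻¹ • x) - F x|) :=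
      (((hFint.comp_smul (inv_ne_zero hb0.ne')).const_mul _).sub hFint).abs
    calc ∫⁻ x : Space, ENNReal.ofReal |(scaledPotential u b ‖x‖).toReal - (u ‖x‖).toReal|
        = ∫⁻ x : Space, ENNReal.ofReal |(b ^ 2)⁻¹ * F (b⁻¹ • x) - F x| :=
          lintegral_congr fun x => hwx x
      _ = ENNReal.ofReal (∫ x : Space, |(b ^ 2)⁻¹ * F (b⁻¹ • x) - F x|) :=
          (ofReal_integral_eq_lintegral_ofReal hI (ae_of_all _ fun x => abs_nonneg _)).symm
      _ ≤ ENNReal.ofReal η := ENNReal.ofReal_le_ofReal (hclose b hbϑ)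
  · -- `u_b ≤ u + w`
    intro x
    exact dil_le_add_ofReal_abs_sub (hscfin _) (hufin _)
  · -- `u ≤ u_b + w`
    intro x
    exact dil_le_add_ofReal_abs_sub' (hscfin _) (hufin _)

end Summit.AtomisticToContinuum.BoseEinsteinCondensation.Cruxes.GDTransfer.Seeded

end
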